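import Literature.MathematicalPhysics.QuantumManyBody.PeriodicBoseGasCouplingPath
import Literature.MathematicalPhysics.QuantumManyBody.PeriodicBoseGasMomentumSector
import Literature.MathematicalPhysics.QuantumManyBody.WeightedCorrector
import HarnessLib

/-!
# The slice floor of the impurity coupling path: `E₀^per(N, L) ≤ E_{λ=0}(N, L)`

Topic `Literature/MathematicalPhysics/QuantumManyBody` (companion of `PeriodicBoseGasCouplingPath.lean`;
helper for the registered stub `stub_sliceFloor` of crux `CorrectorClosure`,
stmt-AtomisticToContinuum-12058, line `llp-fidelity-arc`).

At zero impurity–bath coupling the coupled tagged energy of `PeriodicBoseGasCouplingPath.lean` is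
`⟨Ψ, H₀ Ψ⟩ = ∫_{[0,L)^{3(N+1)}} |∇₀Ψ|² + ∑_{j≥1} |∇ⱼΨ|² + (∑_{1≤i<j} v^per(xᵢ-xⱼ)) |Ψ|²`
(`coupledEnergy_zero`). **Slice floor**: its infimum over tagged states dominates the `N`-body bath
ground-state energy, `periodicGroundStateEnergy v N L ≤ coupledGroundStateEnergy v 0 N L`
(`periodicGroundStateEnergy_le_coupledGroundStateEnergy_zero`). Proof: drop `|∇₀Ψ|² ≥ 0`, write
the cell integral with the tagged coordinate outermost (Tonelli, `setLIntegral_cellN_succ_left`),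
and observe that for every frozen impurity position `x₀` the slice `Y ↦ Ψ(x₀, Y)` is a `C¹`,
periodic, Bose-symmetric (unnormalised) `N`-body function whose kinetic density is exactly the bath
part `∑_{j≥1} |∇ⱼΨ|²(x₀, Y)` of the tagged one (`kineticDensity_vecCons_slice`, chain rule along
`Pi.single j.succ`); the variational principle for the normalised slice
(`periodicGroundStateEnergy_mul_normSq_le`, the torus version of the scaling inequality
`E₀ · ∫|φ|² ≤ ∫ |∇φ|² + V|φ|²` of `LiebYngvasonCellMethod.lean`) and `∫_{cell} (slice masses) = 1`
conclude.

## Main statements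

* `periodicGroundStateEnergy_mul_normSq_le` : `E₀^per(N,L) · ∫_{cell^N} |φ|² ≤ ∫_{cell^N} |∇φ|² +
  (∑_{i<j} v^per)|φ|²` for every `C¹`, `Lℤ³`-periodic, Bose-symmetric `φ` (normalise with
  `PeriodicTrialState.ofFun`; trivial if the mass vanishes; the mass is finite by continuity).
* `gradSqAt_vecCons_slice`, `kineticDensity_vecCons_slice` : bath gradients of the slice
  `Y ↦ Ψ(x₀, Y)` are the bath gradients of `Ψ`.
* `periodicGroundStateEnergy_mul_sliceNormSq_le`, `periodicGroundStateEnergy_le_coupledEnergy_zero`,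
  `periodicGroundStateEnergy_le_coupledGroundStateEnergy_zero` : the slice floor.

## References

* [GuentherEtAl2021] N.-E. Guenther, R. Schmidt, G. M. Bruun, V. Gurarie, P. Massignan, *Mobile
  impurity in a Bose–Einstein condensate and the orthogonality catastrophe*, Phys. Rev. A 103 (2021)
  013317: eq. (4) (the impurity Hamiltonian; at `U = 0` it is `-Δ₀ ⊗ 1 + 1 ⊗ H_bath ≥ 1 ⊗ H_bath`).
* [Fournais2020] S. Fournais, *Length scales for BEC in the dilute Bose gas*, (1.1)–(1.2).
-/

noncomputable section

open MeasureTheory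
open scoped ENNReal NNReal

namespace Literature.MathematicalPhysics.QuantumManyBody.BoseGas

variable {N : ℕ} {L : ℝ}

/-! ## Scaling on the torus: `E₀ · ‖φ‖² ≤ ⟨φ, H φ⟩` for unnormalised admissible `φ` -/

/-- A continuous function has finite `L²` mass on the fundamental cell `[0,L)^{3N}` (bounded set,
continuous integrand). [folklore] -/
theorem lintegral_cellN_normSq_ne_top {φ : Config N → ℂ} (hφ : Continuous φ) (L : ℝ) :
    ∫⁻ Y in cellN N L, (‖φ Y‖₊ : ℝ≥0∞) ^ 2 ≠ ⊤ := by
  have hint : IntegrableOn (fun Y => ‖φ Y‖ ^ 2) (cellN N L) volume :=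
    integrableOn_cellN ((hφ.norm).pow 2) L
  have h := hint.hasFiniteIntegral
  rw [HasFiniteIntegral] at h
  refine ne_of_lt (lt_of_le_of_lt (le_of_eq (lintegral_congr fun Y => ?_)) h)
  rw [coe_nnnorm_sq_eq_ofReal, Real.enorm_eq_ofReal (sq_nonneg _)]

/-- `|∇(cφ)|² = |c|² |∇φ|²` pointwise, for a complex constant `c`. [folklore] -/
private theorem kineticDensity_const_mul_slice (c : ℂ) (φ : Config N → ℂ) (Y : Config N) :
    kineticDensity (fun Z => c * φ Z) Y = (‖c‖₊ : ℝ≥0∞) ^ 2 * kineticDensity φ Y := by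
  unfold kineticDensity
  rw [show (fun Z => c * φ Z) = c • φ from rfl, fderiv_const_smul_field, Finset.mul_sum]
  refine Finset.sum_congr rfl fun i _ => ?_
  rw [Finset.mul_sum]
  refine Finset.sum_congr rfl fun a _ => ?_
  rw [Pi.smul_apply, _root_.smul_apply, smul_eq_mul, nnnorm_mul, ENNReal.coe_mul, mul_pow]

/-- **Scaling inequality on the torus.** For every `C¹`, `Lℤ³`-periodic, Bose-symmetric `φ` on
`(ℝ³)^N` (not necessarily normalised),
`E₀^per(N, L) · ∫_{[0,L)^{3N}} |φ|² ≤ ∫_{[0,L)^{3N}} |∇φ|² + (∑_{i<j} v^per(xᵢ - xⱼ)) |φ|²`: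
if the mass vanishes there is nothing to prove, otherwise it is finite (continuity) and `φ/‖φ‖`
(`PeriodicTrialState.ofFun`) is an admissible periodic state whose energy is the right-hand side
divided by the mass. [cite: Fournais2020, (1.1)–(1.2)] -/
theorem periodicGroundStateEnergy_mul_normSq_le (v : ℝ → ℝ≥0∞) {φ : Config N → ℂ}
    (hC : ContDiff ℝ 1 φ)
    (hper : ∀ (Y : Config N) (i : Fin N) (a : Fin 3),
      φ (Y + Pi.single i (EuclideanSpace.single a L)) = φ Y)
    (hsymm : ∀ (σ : Equiv.Perm (Fin N)) (Y : Config N), φ (Y ∘ σ) = φ Y) :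
    periodicGroundStateEnergy v N L * ∫⁻ Y in cellN N L, (‖φ Y‖₊ : ℝ≥0∞) ^ 2 ≤
      ∫⁻ Y in cellN N L, kineticDensity φ Y + periodicInteraction v L Y * (‖φ Y‖₊ : ℝ≥0∞) ^ 2 := by
  have hmtop : (∫⁻ Y in cellN N L, (‖φ Y‖₊ : ℝ≥0∞) ^ 2) ≠ ⊤ :=
    lintegral_cellN_normSq_ne_top hC.continuous L
  rcases eq_or_ne (∫⁻ Y in cellN N L, (‖φ Y‖₊ : ℝ≥0∞) ^ 2) 0 with hm0 | hm0
  · rw [hm0, mul_zero]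
    exact zero_le
  have hmpos : 0 < (∫⁻ Y in cellN N L, (‖φ Y‖₊ : ℝ≥0∞) ^ 2).toReal := ENNReal.toReal_pos hm0 hmtop
  -- the normalising constant
  have hc2 : ((‖((Real.sqrt (∫⁻ Y in cellN N L, (‖φ Y‖₊ : ℝ≥0∞) ^ 2).toReal)⁻¹ : ℂ)‖₊ : ℝ≥0∞)) ^ 2 =
      (∫⁻ Y in cellN N L, (‖φ Y‖₊ : ℝ≥0∞) ^ 2)⁻¹ := by
    rw [coe_nnnorm_sq_eq_ofReal, norm_inv, Complex.norm_real, Real.norm_of_nonneg (Real.sqrt_nonneg _),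
      inv_pow, Real.sq_sqrt hmpos.le, ENNReal.ofReal_inv_of_pos hmpos, ENNReal.ofReal_toReal hmtop]
  -- the energy of the normalised state `φ/‖φ‖`
  have hE : periodicEnergy v (PeriodicTrialState.ofFun φ hC hper hsymm hm0 hmtop) =
      (∫⁻ Y in cellN N L, (‖φ Y‖₊ : ℝ≥0∞) ^ 2)⁻¹ *
        ∫⁻ Y in cellN N L, kineticDensity φ Y + periodicInteraction v L Y * (‖φ Y‖₊ : ℝ≥0∞) ^ 2 := by
    unfold periodicEnergy
    rw [← hc2, ← lintegral_const_mul' _ _ (ENNReal.pow_ne_top ENNReal.coe_ne_top)]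
    refine lintegral_congr fun Y => ?_
    change kineticDensity (fun Z => ((Real.sqrt (∫⁻ Y in cellN N L,
        (‖φ Y‖₊ : ℝ≥0∞) ^ 2).toReal)⁻¹ : ℂ) * φ Z) Y + periodicInteraction v L Y *
      ((‖((Real.sqrt (∫⁻ Y in cellN N L, (‖φ Y‖₊ : ℝ≥0∞) ^ 2).toReal)⁻¹ : ℂ) * φ Y‖₊ : ℝ≥0∞)) ^ 2 = _
    rw [kineticDensity_const_mul_slice, nnnorm_mul, ENNReal.coe_mul, mul_pow]
    ring
  calc periodicGroundStateEnergy v N L * ∫⁻ Y in cellN N L, (‖φ Y‖₊ : ℝ≥0∞) ^ 2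
      ≤ periodicEnergy v (PeriodicTrialState.ofFun φ hC hper hsymm hm0 hmtop) *
          ∫⁻ Y in cellN N L, (‖φ Y‖₊ : ℝ≥0∞) ^ 2 :=
        mul_le_mul_left (periodicGroundStateEnergy_le v _) _
    _ = _ := by
        rw [hE, mul_comm _⁻¹, mul_assoc, ENNReal.inv_mul_cancel hm0 hmtop, mul_one]

/-! ## Slices of an `(N+1)`-body function at a frozen position of particle `0` -/

/-- `(0, e_j ⊗ u) = e_{j+1} ⊗ u` in `(ℝ³)^{N+1}`. [folklore] -/
theorem vecCons_zero_single (j : Fin N) (u : Space) :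
    (Matrix.vecCons (0 : Space) (Pi.single j u) : Config (N + 1)) = Pi.single j.succ u := by
  funext i
  refine Fin.cases ?_ (fun i => ?_) i
  · simp [Fin.succ_ne_zero]
  · simp [Pi.single_apply, Fin.succ_inj]

/-- Moving bath particle `j` of `(x₀, Y)` is moving particle `j + 1`:
`(x₀, Y + e_j ⊗ u) = (x₀, Y) + e_{j+1} ⊗ u`. [folklore] -/
theorem vecCons_add_single (x : Space) (Y : Config N) (j : Fin N) (u : Space) :
    (Matrix.vecCons x (Y + Pi.single j u) : Config (N + 1)) =
      Matrix.vecCons x Y + Pi.single j.succ u := by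
  rw [← vecCons_zero_single, Matrix.cons_add_cons, add_zero]

/-- Inserting a frozen particle `0`, `Y ↦ (x₀, Y)`, is smooth (affine). [folklore] -/
theorem contDiff_vecCons_right {n : WithTop ℕ∞} (x : Space) :
    ContDiff ℝ n fun Y : Config N => (Matrix.vecCons x Y : Config (N + 1)) := by
  refine contDiff_pi.2 fun i => ?_
  refine Fin.cases ?_ (fun j => ?_) i
  · simp only [Matrix.cons_val_zero]
    exact contDiff_const
  · simp only [Matrix.cons_val_succ]
    exact contDiff_apply ℝ Space j

/-- **Chain rule along the bath directions**: the `j`-th partial gradient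
`|∇ⱼφ|²(Y) = ∑ₖ |∂φ/∂y_{j,k}(Y)|²` of the slice `φ = Ψ(x₀, ·)` at `Y` is the `(j+1)`-st partial
gradient of `Ψ` at `(x₀, Y)`. [folklore] -/
theorem gradSqAt_vecCons_slice {Ψ : Config (N + 1) → ℂ} (hΨ : Differentiable ℝ Ψ) (x : Space)
    (Y : Config N) (j : Fin N) :
    ∑ k : Fin 3, (‖fderiv ℝ (fun Z : Config N => Ψ (Matrix.vecCons x Z)) Y
        (Pi.single j (EuclideanSpace.single k (1 : ℝ)))‖₊ : ℝ≥0∞) ^ 2 =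
      ∑ k : Fin 3, (‖fderiv ℝ Ψ (Matrix.vecCons x Y)
        (Pi.single j.succ (EuclideanSpace.single k (1 : ℝ)))‖₊ : ℝ≥0∞) ^ 2 := by
  have hφ : Differentiable ℝ fun Z : Config N => Ψ (Matrix.vecCons x Z) :=
    hΨ.comp ((contDiff_vecCons_right (n := 1) x).differentiable one_ne_zero)
  have h1 := gradSqC_slice hφ Y j (Y j)
  simp only [Function.update_eq_self] at h1
  have h2 := gradSqC_slice hΨ (Matrix.vecCons x Y) j.succ (Y j)
  have hupd : Function.update (Matrix.vecCons x Y : Config (N + 1)) j.succ (Y j) =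
      Matrix.vecCons x Y := by
    rw [Matrix.vecCons, ← Fin.cons_update, Function.update_eq_self]
  rw [hupd] at h2
  rw [← h1, ← h2]
  congr 1
  funext y
  show Ψ (Matrix.vecCons x (Function.update Y j y)) = _
  rw [Matrix.vecCons, Fin.cons_update]
  rfl

/-- **The kinetic density of a slice is the bath kinetic density**:
`|∇(Ψ(x₀, ·))|²(Y) = ∑_{j≥1} |∇ⱼΨ|²(x₀, Y) = taggedKineticDensity 0 Ψ (x₀, Y)`. [folklore] -/
theorem kineticDensity_vecCons_slice {Ψ : Config (N + 1) → ℂ} (hΨ : Differentiable ℝ Ψ) (x : Space)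
    (Y : Config N) :
    kineticDensity (fun Z : Config N => Ψ (Matrix.vecCons x Z)) Y =
      taggedKineticDensity 0 Ψ (Matrix.vecCons x Y) := by
  rw [taggedKineticDensity_zero, kineticDensity]
  exact Finset.sum_congr rfl fun j _ => gradSqAt_vecCons_slice hΨ x Y j

/-- The slice `Y ↦ Ψ(x₀, Y)` of a tagged state is `C¹`. [folklore] -/
theorem TaggedPeriodicTrialState.contDiff_bathSlice (Ψ : TaggedPeriodicTrialState N L) (x : Space) :
    ContDiff ℝ 1 fun Y : Config N => Ψ.ψ (Matrix.vecCons x Y) :=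
  Ψ.contDiff.comp (contDiff_vecCons_right x)

/-- The slice `Y ↦ Ψ(x₀, Y)` of a tagged state is `Lℤ³`-periodic in every bath particle.
[folklore] -/
theorem TaggedPeriodicTrialState.bathSlice_periodic (Ψ : TaggedPeriodicTrialState N L) (x : Space)
    (Y : Config N) (j : Fin N) (a : Fin 3) :
    Ψ.ψ (Matrix.vecCons x (Y + Pi.single j (EuclideanSpace.single a L))) =
      Ψ.ψ (Matrix.vecCons x Y) := by
  rw [vecCons_add_single, Ψ.periodic]

/-- The slice mass `x₀ ↦ ∫_{[0,L)^{3N}} |Ψ(x₀, Y)|² dY` is measurable. [folklore] -/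
theorem measurable_setLIntegral_normSq_vecCons {Ψ : Config (N + 1) → ℂ} (hΨ : Measurable Ψ) :
    Measurable fun x : Space => ∫⁻ Y in cellN N L, (‖Ψ (Matrix.vecCons x Y)‖₊ : ℝ≥0∞) ^ 2 := by
  have hF : Measurable (Function.uncurry fun (x : Space) (Y : Config N) =>
      (‖Ψ (Matrix.vecCons x Y)‖₊ : ℝ≥0∞) ^ 2) :=
    (hΨ.comp measurable_vecCons).nnnorm.coe_nnreal_ennreal.pow_const _
  exact hF.lintegral_prod_right

/-! ## The slice floor -/

/-- The periodised potential of a measurable profile is measurable. [folklore] -/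
private theorem measurable_periodizedPotential_slice {v : ℝ → ℝ≥0∞} (hv : Measurable v) (L : ℝ) :
    Measurable (periodizedPotential v L) := by
  show Measurable fun x => ∑' n : Fin 3 → ℤ, v ‖x - latticeVec L n‖
  exact Measurable.tsum fun n => hv.comp (measurable_id.sub_const _).norm

/-- The periodic pair interaction of a measurable profile is measurable. [folklore] -/
private theorem measurable_periodicInteraction_slice {v : ℝ → ℝ≥0∞} (hv : Measurable v) (L : ℝ)
    {M : ℕ} : Measurable fun X : Config M => periodicInteraction v L X := by
  unfold periodicInteraction
  refine Finset.measurable_sum _ fun i _ => Finset.measurable_sum _ fun j _ => ?_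
  exact (measurable_periodizedPotential_slice hv L).comp
    ((measurable_pi_apply i).sub (measurable_pi_apply j))

/-- **Slice by slice.** For a tagged state `Ψ` and every frozen impurity position `x₀`,
`E₀^per(N, L) · ∫_{[0,L)^{3N}} |Ψ(x₀, Y)|² dY ≤
∫_{[0,L)^{3N}} (∑_{j≥1} |∇ⱼΨ|² + (∑_{1≤i<j} v^per(xᵢ - xⱼ)) |Ψ|²)(x₀, Y) dY`: the slice is an
unnormalised admissible `N`-boson function (`C¹`, periodic, Bose-symmetric by the bath symmetry of
`Ψ`) with kinetic density `∑_{j≥1} |∇ⱼΨ|²(x₀, ·)`. [folklore] -/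
theorem periodicGroundStateEnergy_mul_sliceNormSq_le (v : ℝ → ℝ≥0∞)
    (Ψ : TaggedPeriodicTrialState N L) (x : Space) :
    periodicGroundStateEnergy v N L *
        ∫⁻ Y in cellN N L, (‖Ψ.ψ (Matrix.vecCons x Y)‖₊ : ℝ≥0∞) ^ 2 ≤
      ∫⁻ Y in cellN N L, taggedKineticDensity 0 Ψ.ψ (Matrix.vecCons x Y) +
        periodicInteraction v L Y * (‖Ψ.ψ (Matrix.vecCons x Y)‖₊ : ℝ≥0∞) ^ 2 := by
  have h := periodicGroundStateEnergy_mul_normSq_le v (Ψ.contDiff_bathSlice x)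
    (Ψ.bathSlice_periodic x) (fun σ Y => Ψ.symm_vecCons σ x Y)
  refine h.trans (le_of_eq (lintegral_congr fun Y => ?_))
  rw [kineticDensity_vecCons_slice (Ψ.contDiff.differentiable one_ne_zero)]

/-- **Slice floor, state by state**: `E₀^per(N, L) ≤ ⟨Ψ, H₀ Ψ⟩` for every tagged state `Ψ` and
measurable `v` — drop the impurity's kinetic term, integrate the slice inequality
`periodicGroundStateEnergy_mul_sliceNormSq_le` over `x₀ ∈ [0,L)³` (Tonelli, tagged coordinate
outermost) and use `∫_{[0,L)³} ∫_{[0,L)^{3N}} |Ψ(x₀, Y)|² dY dx₀ = 1`.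
[cite: GuentherEtAl2021, eq. (4) (U = 0: H₀ = -Δ₀ + H_bath ≥ E₀(bath))] -/
theorem periodicGroundStateEnergy_le_coupledEnergy_zero {v : ℝ → ℝ≥0∞} (hv : Measurable v)
    (Ψ : TaggedPeriodicTrialState N L) : periodicGroundStateEnergy v N L ≤ coupledEnergy v 0 Ψ := by
  have hΨm : Measurable Ψ.ψ := Ψ.contDiff.continuous.measurable
  have hnorm : Measurable fun X => (‖Ψ.ψ X‖₊ : ℝ≥0∞) ^ 2 :=
    hΨm.nnnorm.coe_nnreal_ennreal.pow_const _
  have hGm : Measurable fun X : Config (N + 1) => taggedKineticDensity 0 Ψ.ψ X +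
      periodicInteraction v L (Matrix.vecTail X) * (‖Ψ.ψ X‖₊ : ℝ≥0∞) ^ 2 :=
    (measurable_taggedKineticDensity 0 _).add
      (((measurable_periodicInteraction_slice hv L).comp measurable_vecTail).mul hnorm)
  -- Tonelli for the mass and for the truncated energy
  have h1 := setLIntegral_cellN_succ_left (L := L) hnorm
  rw [Ψ.norm_eq] at h1
  have key := setLIntegral_cellN_succ_left (L := L) hGm
  simp only [Matrix.tail_cons] at key
  calc periodicGroundStateEnergy v N L
      = periodicGroundStateEnergy v N L *
          ∫⁻ x in cell L, ∫⁻ Y in cellN N L, (‖Ψ.ψ (Matrix.vecCons x Y)‖₊ : ℝ≥0∞) ^ 2 := by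
        rw [← h1, mul_one]
    _ = ∫⁻ x in cell L, periodicGroundStateEnergy v N L *
          ∫⁻ Y in cellN N L, (‖Ψ.ψ (Matrix.vecCons x Y)‖₊ : ℝ≥0∞) ^ 2 :=
        (lintegral_const_mul _ (measurable_setLIntegral_normSq_vecCons hΨm)).symm
    _ ≤ ∫⁻ x in cell L, ∫⁻ Y in cellN N L, taggedKineticDensity 0 Ψ.ψ (Matrix.vecCons x Y) +
          periodicInteraction v L Y * (‖Ψ.ψ (Matrix.vecCons x Y)‖₊ : ℝ≥0∞) ^ 2 :=
        lintegral_mono fun x => periodicGroundStateEnergy_mul_sliceNormSq_le v Ψ x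
    _ = ∫⁻ X in cellN (N + 1) L, taggedKineticDensity 0 Ψ.ψ X +
          periodicInteraction v L (Matrix.vecTail X) * (‖Ψ.ψ X‖₊ : ℝ≥0∞) ^ 2 := key.symm
    _ ≤ coupledEnergy v 0 Ψ := by
        rw [coupledEnergy_zero]
        exact lintegral_mono fun X =>
          add_le_add (taggedKineticDensity_mono zero_le_one Ψ.ψ X) le_rfl

/-- **The slice floor of the coupling path**: the decoupled ground-state energy dominates the bath
ground-state energy, `periodicGroundStateEnergy v N L ≤ coupledGroundStateEnergy v 0 N L`
(`E₀^per(N, L) ≤ E_{λ=0}(N, L)`; for `L ≤ 0` both sides are `⊤`/there are no tagged states).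
[cite: GuentherEtAl2021, eq. (4) (U = 0: H₀ = -Δ₀ + H_bath ≥ E₀(bath))] -/
theorem periodicGroundStateEnergy_le_coupledGroundStateEnergy_zero {v : ℝ → ℝ≥0∞}
    (hv : Measurable v) (N : ℕ) (L : ℝ) :
    periodicGroundStateEnergy v N L ≤ coupledGroundStateEnergy v 0 N L :=
  le_iInf fun Ψ => periodicGroundStateEnergy_le_coupledEnergy_zero hv Ψ

end Literature.MathematicalPhysics.QuantumManyBody.BoseGas

end
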